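import Literature.AnabelianGeometry.AbsoluteAnabelian.MLFGaloisUnitsRigidityProofs
import Literature.AnabelianGeometry.AbsoluteAnabelian.MonoidKummerMapsUnitPairProofs
import HarnessLib

/-!
# [AbsTopIII] Prop 3.3 (ii) for `T = TLG`: the fibres of `Isom((Π ↷ M),(Π* ↷ M*)) → Isom(Π, Π*)`
# have exactly two elements (proved, given one lift); the named fact reduces to the lifting statement

Proof-only companion (theorems only, no new definitions) of `MonoidKummerMaps.lean` (seat
abc-iut-L4-t2; S. Mochizuki, *Topics in Absolute Anabelian Geometry III*, Prop. 3.3 (ii) p. 74,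
kurims manuscript, lit key `paper:url-5493eb38cbb7`: "if `T = TLG`, then the resulting map
`Isom((Π ↷ M),(Π* ↷ M*)) → Isom(Π, Π*)` is surjective, with fibers of cardinality two").

* `unitPairIso_fibre_two_of_exists_lift` — for MLF-Galois `TLG`-pairs `P`, `Q` and an isomorphism
  `f : Π_P ⥲ Π_Q` admitting ONE lift `e` to an isomorphism of pairs, there are exactly two lifts: `e`
  and `e ∘ (·)⁻¹` (PROVED: a second lift differs from `e` by a `G_k`-equivariant automorphism of the
  model `k̄^×`, which is `id` or the inversion — `MLFClosure.nonZeroDivisors_mulEquiv_eq_self_or_eq_inv`,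
  `MLFGaloisUnitsRigidityProofs.lean`; and `e ∘ (·)⁻¹ ≠ e` since `2⁻¹ ≠ 2` in `k̄`).
* `unitPairIsoFibres_iff_exists_lift` — together with the determination half
  (`unitPairIso_isoM_eq`, `MonoidKummerMapsUnitPairProofs.lean`) the named fact `UnitPairIsoFibres`
  REDUCES to the pure LIFTING statement "every `𝒯𝒢`-isomorphism `Π_P ⥲ Π_Q` of MLF-Galois `TLG`-pairs
  lifts to an isomorphism of pairs" (the surjectivity sentence; local class field theory /
  [AbsAnab] Prop. 1.2.1 — not proved here).

HONEST FRAMING: OUR kernel check of (part of) a statement of a refereed paper; nothing here bears on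
[IUTchIII] Cor. 3.12.
-/

noncomputable section

open scoped Classical

namespace Literature.AnabelianGeometry.AbsoluteAnabelian

open Literature.AnabelianGeometry.EtaleTheta

/-- **[AbsTopIII] Prop 3.3 (ii), `T = TLG`, fibres of cardinality two (given one lift) — PROVED.**
For MLF-Galois `TLG`-pairs `P, Q` and `f : Π_P ⥲ Π_Q`, if some isomorphism of pairs lifts `f`, then
exactly two do: writing `e` for one of them, every lift is `e` or `e ∘ (·)⁻¹`, and these differ.
[cite: MochizukiAbsTopIII2015, Proposition 3.3 (ii) p.74] -/
theorem unitPairIso_fibre_two_of_exists_lift (P Q : GaloisMonoidPair.{0})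
    (hP : IsMLFGaloisMonoidPair .TLG P) (f : P.Pi ≃ₜ* Q.Pi)
    (hlift : ∃ e : GaloisMonoidPair.Iso P Q, e.isoPi = f) :
    ∃ e₁ e₂ : GaloisMonoidPair.Iso P Q, e₁.isoPi = f ∧ e₂.isoPi = f ∧ e₁.isoM ≠ e₂.isoM ∧
      ∀ e : GaloisMonoidPair.Iso P Q, e.isoPi = f → (e.isoM = e₁.isoM ∨ e.isoM = e₂.isoM) := by
  obtain ⟨e, he⟩ := hlift
  obtain ⟨C, D, Q₀, hQ₀, ⟨ι⟩⟩ := hP.exists_model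
  simp only [ModelMLFGaloisData.monoidPair, Option.some.injEq] at hQ₀
  subst hQ₀
  haveI : IsAlgClosed C.K := IsAlgClosure.isAlgClosed C.k
  haveI : CharZero C.K := charZero_of_injective_algebraMap (algebraMap C.k C.K).injective
  -- the inversion of the model object `k̄^×`
  let invND : ↥(nonZeroDivisors C.K) ≃* ↥(nonZeroDivisors C.K) :=
    { toFun := fun z => ⟨(z : C.K)⁻¹, mem_nonZeroDivisors_of_ne_zero
        (inv_ne_zero (nonZeroDivisors.coe_ne_zero z))⟩
      invFun := fun z => ⟨(z : C.K)⁻¹, mem_nonZeroDivisors_of_ne_zero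
        (inv_ne_zero (nonZeroDivisors.coe_ne_zero z))⟩
      left_inv := fun z => Subtype.ext (inv_inv (z : C.K))
      right_inv := fun z => Subtype.ext (inv_inv (z : C.K))
      map_mul' := fun a b => Subtype.ext (by
        show ((a * b : ↥(nonZeroDivisors C.K)) : C.K)⁻¹ = (a : C.K)⁻¹ * (b : C.K)⁻¹
        rw [Submonoid.coe_mul, mul_inv]) }
  have hinvND : ∀ z : ↥(nonZeroDivisors C.K), (invND z : C.K) = (z : C.K)⁻¹ := fun z => rfl
  -- the action of `g ∈ Π_k` on the model object is through `ε_k g`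
  have hsmul : ∀ (g : D.Pi) (z : ↥(nonZeroDivisors C.K)),
      ((@HSMul.hSMul D.Pi ↥(nonZeroDivisors C.K) _ (@instHSMul _ _ (D.submonoidAction
        (nonZeroDivisors C.K) (fun σ _ h => smul_mem_nonZeroDivisors σ h)).toSMul) g z
          : ↥(nonZeroDivisors C.K)) : C.K) = D.aug g (z : C.K) := fun g z => rfl
  -- inversion commutes with the model action
  have hinv_smul : ∀ (g : D.Pi) (z : ↥(nonZeroDivisors C.K)),
      invND (@HSMul.hSMul D.Pi ↥(nonZeroDivisors C.K) _ (@instHSMul _ _ (D.submonoidAction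
        (nonZeroDivisors C.K) (fun σ _ h => smul_mem_nonZeroDivisors σ h)).toSMul) g z) =
      @HSMul.hSMul D.Pi ↥(nonZeroDivisors C.K) _ (@instHSMul _ _ (D.submonoidAction
        (nonZeroDivisors C.K) (fun σ _ h => smul_mem_nonZeroDivisors σ h)).toSMul) g (invND z) := by
    intro g z
    apply Subtype.ext
    rw [hinvND, hsmul, hsmul, hinvND, map_inv₀]
  -- the inversion of `P.M`, transported along `ι`
  let invP : P.M ≃* P.M := ι.isoM.symm.trans (invND.trans ι.isoM)
  have hinvP : ∀ p : P.M, invP p = ι.isoM (invND (ι.isoM.symm p)) := fun p => rfl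
  have hinvP_smul : ∀ (g : P.Pi) (p : P.M), invP (g • p) = g • invP p := by
    intro g p
    rw [hinvP, hinvP, GaloisMonoidPair.Iso.symm_smul_comm, hinv_smul, ι.smul_comm,
      ContinuousMulEquiv.apply_symm_apply]
  -- the second lift `e₂ = e ∘ inv`
  let e₂ : GaloisMonoidPair.Iso P Q :=
    { isoPi := e.isoPi
      isoM := invP.trans e.isoM
      smul_comm := fun g p => by
        show e.isoM (invP (g • p)) = e.isoPi g • e.isoM (invP p)
        rw [hinvP_smul, e.smul_comm] }
  have he₂M : ∀ p : P.M, e₂.isoM p = e.isoM (invP p) := fun p => rfl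
  refine ⟨e, e₂, he, he, ?_, ?_⟩
  · -- `e ≠ e ∘ inv`: evaluate at `ι(2)`
    intro hEq
    have h2 : (2 : C.K) ≠ 0 := two_ne_zero
    set two : ↥(nonZeroDivisors C.K) := ⟨2, mem_nonZeroDivisors_of_ne_zero h2⟩ with htwo
    have h := congrArg (fun φ : P.M ≃* Q.M => φ (ι.isoM two)) hEq
    simp only [he₂M, hinvP, MulEquiv.symm_apply_apply] at h
    have h' := ι.isoM.injective (e.isoM.injective h)
    have h'' : (2 : C.K) = 2⁻¹ := by
      have := congrArg (fun z : ↥(nonZeroDivisors C.K) => (z : C.K)) h'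
      simpa [htwo, hinvND] using this
    have h4 : (2 : C.K) * 2 = 1 := by
      nth_rewrite 2 [h'']
      exact mul_inv_cancel₀ h2
    norm_num at h4
  · -- every lift is `e` or `e ∘ inv`
    intro e' he'
    -- `γ := ι ≫ e' ≫ e⁻¹ ≫ ι⁻¹`, an equivariant automorphism of the model `k̄^×`
    set γ : ↥(nonZeroDivisors C.K) ≃* ↥(nonZeroDivisors C.K) :=
      ι.isoM.trans (e'.isoM.trans (e.isoM.symm.trans ι.isoM.symm)) with hγdef
    have hγ_apply : ∀ z, γ z = ι.isoM.symm (e.isoM.symm (e'.isoM (ι.isoM z))) := fun z => rfl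
    have hγ_smul : ∀ (g : D.Pi) (z : ↥(nonZeroDivisors C.K)),
        γ (@HSMul.hSMul D.Pi ↥(nonZeroDivisors C.K) _ (@instHSMul _ _ (D.submonoidAction
          (nonZeroDivisors C.K) (fun σ _ h => smul_mem_nonZeroDivisors σ h)).toSMul) g z) =
        @HSMul.hSMul D.Pi ↥(nonZeroDivisors C.K) _ (@instHSMul _ _ (D.submonoidAction
          (nonZeroDivisors C.K) (fun σ _ h => smul_mem_nonZeroDivisors σ h)).toSMul) g (γ z) := by
      intro g z
      rw [hγ_apply, hγ_apply, ι.smul_comm, e'.smul_comm, GaloisMonoidPair.Iso.symm_smul_comm,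
        GaloisMonoidPair.Iso.symm_smul_comm, he', ← he, ContinuousMulEquiv.symm_apply_apply,
        ContinuousMulEquiv.symm_apply_apply]
    have hγ : ∀ (σ : C.K ≃ₐ[C.k] C.K) (z : ↥(nonZeroDivisors C.K)),
        (γ ⟨σ • (z : C.K), smul_mem_nonZeroDivisors σ z.2⟩ : C.K) = σ • (γ z : C.K) := by
      intro σ z
      obtain ⟨g, rfl⟩ := D.aug_surjective σ
      have hgz : (⟨D.aug g • (z : C.K), smul_mem_nonZeroDivisors (D.aug g) z.2⟩ :
          ↥(nonZeroDivisors C.K)) =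
          @HSMul.hSMul D.Pi ↥(nonZeroDivisors C.K) _ (@instHSMul _ _ (D.submonoidAction
            (nonZeroDivisors C.K) (fun σ _ h => smul_mem_nonZeroDivisors σ h)).toSMul) g z :=
        Subtype.ext rfl
      rw [hgz, AlgEquiv.smul_def]
      have h := congrArg (fun w : ↥(nonZeroDivisors C.K) => (w : C.K)) (hγ_smul g z)
      simp only [hsmul] at h
      exact h
    rcases MLFClosure.nonZeroDivisors_mulEquiv_eq_self_or_eq_inv γ hγ with hid | hinv
    · left
      apply MulEquiv.ext
      intro p
      have h1 := hid (ι.isoM.symm p)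
      rw [hγ_apply, MulEquiv.apply_symm_apply] at h1
      have h2 := congrArg ι.isoM h1
      rw [MulEquiv.apply_symm_apply, MulEquiv.apply_symm_apply] at h2
      have h3 := congrArg e.isoM h2
      rw [MulEquiv.apply_symm_apply] at h3
      exact h3
    · right
      apply MulEquiv.ext
      intro p
      have h1 : γ (ι.isoM.symm p) = invND (ι.isoM.symm p) := Subtype.ext (hinv (ι.isoM.symm p))
      rw [hγ_apply, MulEquiv.apply_symm_apply] at h1
      have h2 := congrArg ι.isoM h1
      rw [MulEquiv.apply_symm_apply] at h2
      have h3 := congrArg e.isoM h2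
      rw [MulEquiv.apply_symm_apply] at h3
      rw [h3, he₂M, hinvP]

/-- **The named fact `UnitPairIsoFibres` REDUCES to the lifting statement for `T = TLG`**: with the
determination half (`unitPairIso_isoM_eq`) and the fibre half (`unitPairIso_fibre_two_of_exists_lift`)
proved, [AbsTopIII] Prop. 3.3 (ii) as typed is equivalent to "for MLF-Galois `TLG`-pairs, every
isomorphism `Π_P ⥲ Π_Q` respecting the arithmetic quotients lifts to an isomorphism of pairs" (the
SURJECTIVITY sentence, p. 74; [AbsAnab] Prop. 1.2.1 / local class field theory — not proved here).
[cite: MochizukiAbsTopIII2015, Proposition 3.3 (ii) p.74] -/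
theorem unitPairIsoFibres_iff_exists_lift :
    UnitPairIsoFibres ↔
      (∀ (P Q : GaloisMonoidPair.{0}), IsMLFGaloisMonoidPair .TLG P → IsMLFGaloisMonoidPair .TLG Q →
        ∀ f : P.Pi ≃ₜ* Q.Pi, P.actionKer.map f.toMulEquiv.toMonoidHom = Q.actionKer →
          ∃ e : GaloisMonoidPair.Iso P Q, e.isoPi = f) := by
  rw [unitPairIsoFibres_iff_surjectivity_half]
  constructor
  · intro h P Q hP hQ f hf
    obtain ⟨e₁, -, he₁, -⟩ := h P Q hP hQ f hf
    exact ⟨e₁, he₁⟩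
  · intro h P Q hP hQ f hf
    exact unitPairIso_fibre_two_of_exists_lift P Q hP f (h P Q hP hQ f hf)

end Literature.AnabelianGeometry.AbsoluteAnabelian

end
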